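import Summits.QuantumFields.BalabanUV.T4Continuum.Support.NE7ApeCurvedRepRoadBGradientClass
import HarnessLib

/-!
# NE7GradientTailArithmetic — THE CURVATURE TAIL OF F123d's GRADIENT MEMBER IS `≤ α_E∕M`: under the class regime lines `23040d⁴(frameC+d)²M²x ≤ 1` and
# `11520d⁴(frameC+d)³M³(2g_W) ≤ 1` and `α_E ≤ 1∕64`, the tail `(4M(8d(e^{4α_E}−1)x + 10dx + 2δ_M + 12da_M²) + 4a_M)α_E + 2xα_E` (`a_M = 2d(M+1)x`, `δ_M = 2d²(M+1)(2g_W) + 8d³(M+1)²x²`)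
# is at most `α_E∕M` — the currency claim of the memo (§4: «one power of M below the sup with level-free smalls») as real arithmetic; file 54e

Cell `pub-balaban`, rung (B)+1 sub-cell t4, lineage `b2b-balaban-t4-ne7-p1` (CRUX PROVER NE7 #1 = OWNER of row NE7), generation 79; memo `t4/b2b-balaban-t4-ne7-p1-g79/GRADIENT-LETTER.md` §4–§5.
Pure real arithmetic (no lattice objects); `B7Prop1Explicit.exp4_sub_one_le` for `e^{4α} − 1 ≤ 8α`.  With it F123d's `α₁^Z ≤ (4d+1)·α_E∕M + 8(d−1)M(g_U + g_W) + 4dM·K + 8M(b₀ + 3c_RE b₀)`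
(`K = 2(e^{α_E}−1)x_U + 2x_Ux + 2x²(2+x) + 2x_U²(2+x_U)`) by adding the main terms verbatim.
WHAT ([folklore]; 0 def, 0 sorry).  `prod_bounds`, `poly_small`, `tail_mono`, `tail_major_eq`, **`gradTail_le`** (the displayed tail bound, every real `M ≥ 2`, `d ≥ 2`, `F ≥ 1`).
HONEST FRAMING (page 1): arithmetic only; nothing of Bałaban's asserted; NOT ONE-STEP, NOT NE7; spine 0∕9; finite T⁴ rung (B)+1 — NOT infinite volume, NOT mass gap, NOT `BetaPertH`, NOT Clay.
Continuum YM on T⁴ ⇐ BetaPertH ∧ nine spine estimates (0/9 proved); BetaPertH ⇐ (D1) ∧ (D4) ∧ CAP+tail; G-an2-4 gates asym, D1 and NE2/3/4.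
-/

set_option autoImplicit false

namespace Summit.QuantumFields.BalabanUV.T4Continuum.NE7GradientTailArithmetic

open Literature.MathematicalPhysics.QuantumFieldTheory.Balaban1983to89
open B7Prop1Explicit (exp4_sub_one_le)

/-- The two LEVEL-FREE products of the class regime: `d⁴·(M²x) ≤ 1∕23040` and `d⁴·(M³g) ≤ 1∕23040` (from the lines with `F ≥ 1`). [folklore] -/
theorem prod_bounds {d M F x g : ℝ} (hM : 0 ≤ M) (hF : 1 ≤ F) (hx : 0 ≤ x) (hg : 0 ≤ g)
    (hbx : 23040 * d ^ 4 * F ^ 2 * M ^ 2 * x ≤ 1) (hcx : 11520 * d ^ 4 * F ^ 3 * M ^ 3 * (2 * g) ≤ 1) :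
    d ^ 4 * (M ^ 2 * x) ≤ 1 / 23040 ∧ d ^ 4 * (M ^ 3 * g) ≤ 1 / 23040 := by
  have hF2 : 1 ≤ F ^ 2 := one_le_pow₀ hF
  have hF3 : 1 ≤ F ^ 3 := one_le_pow₀ hF
  have h0 : 0 ≤ d ^ 4 * (M ^ 2 * x) := by positivity
  have h0' : 0 ≤ d ^ 4 * (M ^ 3 * g) := by positivity
  constructor
  · have h1 : 23040 * (d ^ 4 * (M ^ 2 * x)) * 1 ≤ 23040 * (d ^ 4 * (M ^ 2 * x)) * F ^ 2 := mul_le_mul_of_nonneg_left hF2 (by positivity)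
    have h2 : 23040 * (d ^ 4 * (M ^ 2 * x)) * F ^ 2 = 23040 * d ^ 4 * F ^ 2 * M ^ 2 * x := by ring
    rw [le_div_iff₀ (by norm_num)]; linarith
  · have h1 : 23040 * (d ^ 4 * (M ^ 3 * g)) * 1 ≤ 23040 * (d ^ 4 * (M ^ 3 * g)) * F ^ 3 := mul_le_mul_of_nonneg_left hF3 (by positivity)
    have h2 : 23040 * (d ^ 4 * (M ^ 3 * g)) * F ^ 3 = 11520 * d ^ 4 * F ^ 3 * M ^ 3 * (2 * g) := by ring
    rw [le_div_iff₀ (by norm_num)]; linarith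

/-- The level-free polynomial is small: `d ≥ 2`, `d⁴q ≤ 1∕23040`, `d⁴w ≤ 1∕23040`, `q, w ≥ 0` ⇒ `44dq + 64d²w + 1024d³q² + 16dq + q ≤ 1`. [folklore] -/
theorem poly_small {d q w : ℝ} (hd : 2 ≤ d) (hq0 : 0 ≤ q) (hw0 : 0 ≤ w) (hq : d ^ 4 * q ≤ 1 / 23040) (hw : d ^ 4 * w ≤ 1 / 23040) :
    44 * d * q + 64 * d ^ 2 * w + 1024 * d ^ 3 * q ^ 2 + 16 * d * q + q ≤ 1 := by
  have hd0 : 0 ≤ d := by linarith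
  have hd2 : 4 ≤ d ^ 2 := by nlinarith
  have hd3 : 8 ≤ d ^ 3 := by
    have h : d ^ 3 = d * d ^ 2 := by ring
    rw [h]; nlinarith [mul_le_mul hd hd2 (by norm_num) hd0]
  have hd4 : 16 ≤ d ^ 4 := by
    have h : d ^ 4 = d ^ 2 * d ^ 2 := by ring
    rw [h]; nlinarith [mul_le_mul hd2 hd2 (by norm_num) (by positivity)]
  have hdq : d * q ≤ 1 / 184320 := by
    have h3 : 8 * (d * q) ≤ d ^ 4 * q := by nlinarith [mul_nonneg hd0 hq0]
    linarith
  have hd2w : d ^ 2 * w ≤ 1 / 92160 := by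
    have h3 : 4 * (d ^ 2 * w) ≤ d ^ 4 * w := by nlinarith [mul_nonneg (by positivity : (0 : ℝ) ≤ d ^ 2) hw0]
    linarith
  have hd3q : d ^ 3 * q ≤ 1 / 46080 := by
    have h3 : 2 * (d ^ 3 * q) ≤ d ^ 4 * q := by nlinarith [mul_nonneg (by positivity : (0 : ℝ) ≤ d ^ 3) hq0]
    linarith
  have hd3q2 : d ^ 3 * q ^ 2 ≤ 1 / 46080 * q := by nlinarith [hd3q, hq0]
  have hqs : q ≤ 1 / 23040 := by
    have : 1 * q ≤ d ^ 4 * q := by nlinarith [hq0]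
    linarith
  nlinarith

/-- Step 1: inside the tail, `e^{4α} − 1 ≤ 1∕8` (`α ≤ 1∕64`) and `M + 1 ≤ 2M`. [folklore] -/
theorem tail_mono {d M x g α : ℝ} (hd : 0 ≤ d) (hM : 1 ≤ M) (hx : 0 ≤ x) (hg : 0 ≤ g) (hα0 : 0 ≤ α) (hα : α ≤ 1 / 64) :
    4 * M * (8 * d * (Real.exp (4 * α) - 1) * x + 10 * d * x + 2 * (2 * d ^ 2 * (M + 1) * (2 * g) + 8 * d ^ 3 * (M + 1) ^ 2 * x ^ 2)
        + 12 * d * (2 * d * (M + 1) * x) ^ 2) + 4 * (2 * d * (M + 1) * x)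
      ≤ 4 * M * (8 * d * (1 / 8) * x + 10 * d * x + 2 * (2 * d ^ 2 * (2 * M) * (2 * g) + 8 * d ^ 3 * (2 * M) ^ 2 * x ^ 2)
        + 12 * d * (2 * d * (2 * M) * x) ^ 2) + 4 * (2 * d * (2 * M) * x) := by
  have hE := exp4_sub_one_le hα0 hα
  have hE8 : Real.exp (4 * α) - 1 ≤ 1 / 8 := hE.trans (by linarith)
  have hM1 : M + 1 ≤ 2 * M := by linarith
  have hM10 : 0 ≤ M + 1 := by linarith
  have hM0 : 0 ≤ M := by linarith
  gcongr

/-- Step 2: the majorant of step 1, multiplied by `M`, in the products `q = M²x`, `w = M³g`. [folklore] -/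
theorem tail_major_eq (d M x g : ℝ) :
    (4 * M * (8 * d * (1 / 8) * x + 10 * d * x + 2 * (2 * d ^ 2 * (2 * M) * (2 * g) + 8 * d ^ 3 * (2 * M) ^ 2 * x ^ 2)
        + 12 * d * (2 * d * (2 * M) * x) ^ 2) + 4 * (2 * d * (2 * M) * x)) * M
      = 44 * d * (M ^ 2 * x) + 64 * d ^ 2 * (M ^ 3 * g) + 1024 * d ^ 3 * (M ^ 2 * x) ^ 2 + 16 * d * (M ^ 2 * x) := by
  ring

/-- **THE CURVATURE TAIL IS `≤ α∕M`.**  For reals `d ≥ 2`, `M ≥ 2`, `F ≥ 1`, `x, g ≥ 0`, `0 ≤ α ≤ 1∕64` with `23040d⁴F²M²x ≤ 1` and `11520d⁴F³M³(2g) ≤ 1`: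
`(4M(8d(e^{4α}−1)x + 10dx + 2(2d²(M+1)(2g) + 8d³(M+1)²x²) + 12d(2d(M+1)x)²) + 4(2d(M+1)x))α + 2xα ≤ α∕M`. [folklore] -/
theorem gradTail_le {d M F x g α : ℝ} (hd : 2 ≤ d) (hM : 2 ≤ M) (hF : 1 ≤ F) (hx : 0 ≤ x) (hg : 0 ≤ g) (hα0 : 0 ≤ α) (hα : α ≤ 1 / 64)
    (hbx : 23040 * d ^ 4 * F ^ 2 * M ^ 2 * x ≤ 1) (hcx : 11520 * d ^ 4 * F ^ 3 * M ^ 3 * (2 * g) ≤ 1) :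
    (4 * M * (8 * d * (Real.exp (4 * α) - 1) * x + 10 * d * x + 2 * (2 * d ^ 2 * (M + 1) * (2 * g) + 8 * d ^ 3 * (M + 1) ^ 2 * x ^ 2)
        + 12 * d * (2 * d * (M + 1) * x) ^ 2) + 4 * (2 * d * (M + 1) * x)) * α + 2 * x * α ≤ α / M := by
  have hM0 : 0 < M := by linarith
  have hd0 : 0 ≤ d := by linarith
  obtain ⟨hq, hw⟩ := prod_bounds hM0.le hF hx hg hbx hcx
  have h1 := tail_mono hd0 (by linarith : (1 : ℝ) ≤ M) hx hg hα0 hα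
  have h2 := tail_major_eq d M x g
  have hq0 : 0 ≤ M ^ 2 * x := by positivity
  have hw0 : 0 ≤ M ^ 3 * g := by positivity
  have hS := poly_small hd hq0 hw0 hq hw
  have hMx : 2 * x * M ≤ M ^ 2 * x := by nlinarith
  rw [le_div_iff₀ hM0]
  calc ((4 * M * (8 * d * (Real.exp (4 * α) - 1) * x + 10 * d * x + 2 * (2 * d ^ 2 * (M + 1) * (2 * g) + 8 * d ^ 3 * (M + 1) ^ 2 * x ^ 2)
          + 12 * d * (2 * d * (M + 1) * x) ^ 2) + 4 * (2 * d * (M + 1) * x)) * α + 2 * x * α) * M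
      = (4 * M * (8 * d * (Real.exp (4 * α) - 1) * x + 10 * d * x + 2 * (2 * d ^ 2 * (M + 1) * (2 * g) + 8 * d ^ 3 * (M + 1) ^ 2 * x ^ 2)
          + 12 * d * (2 * d * (M + 1) * x) ^ 2) + 4 * (2 * d * (M + 1) * x)) * M * α + (2 * x * M) * α := by ring
    _ ≤ (44 * d * (M ^ 2 * x) + 64 * d ^ 2 * (M ^ 3 * g) + 1024 * d ^ 3 * (M ^ 2 * x) ^ 2 + 16 * d * (M ^ 2 * x)) * α + (M ^ 2 * x) * α := by
        rw [← h2]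
        exact add_le_add (mul_le_mul_of_nonneg_right (mul_le_mul_of_nonneg_right h1 hM0.le) hα0) (mul_le_mul_of_nonneg_right hMx hα0)
    _ = (44 * d * (M ^ 2 * x) + 64 * d ^ 2 * (M ^ 3 * g) + 1024 * d ^ 3 * (M ^ 2 * x) ^ 2 + 16 * d * (M ^ 2 * x) + M ^ 2 * x) * α := by ring
    _ ≤ 1 * α := mul_le_mul_of_nonneg_right hS hα0
    _ = α := one_mul α

end Summit.QuantumFields.BalabanUV.T4Continuum.NE7GradientTailArithmetic
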